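/-
Origin: expansion seat `planner-pub-hodgecm-pv09-g7-0`, handover #1 2026-08-18T12:57:59Z (md5 844a968d6dbbd4ac5a6cd5618c5f1417; NEW additive leaf; ONE import rewrite Pv13g5.RestrictedTensorL2 -> HodgeCM.PerL34.RestrictedTensorL2 (pv13-g5 RUN-30 #1 348e5d22); land AFTER HodgeCM/PerL34/RestrictedTensorL2.lean; HOLD iff that row is held) (`HOME/pub-hodgecm-pv09-g7/lean/Pv09g7/RestrictedTensorFunctor.lean`, md5 844a968d, 412 lines);
landed by the gen-8 packager in gate run 30 as `HodgeCM/PerL34/RestrictedTensorFunctor.lean` (import ^import Pv13g5\.RestrictedTensorL2[ \t]*$→import HodgeCM.PerL34.RestrictedTensorL2 ×1).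
-/
/-
Copyright: HodgeCM publication cell (pub-hodgecm), seam S3 (𝓕-side / genuine idelic torus end; the
representation-side INPUT of `GenuineThetaInput`).  Prover seat pub-hodgecm-pv09-g7 (DAG-node
prover #09, generation 7), file #1; intended final place
`HodgeCM/PerL34/RestrictedTensorFunctor.lean`.  WIP import: `Pv13g5.RestrictedTensorL2` ↦
`HodgeCM.PerL34.RestrictedTensorL2` (pv13-g5 file #1, which supplies the universal property
`RestrictedTensor.lift` over pv09-g6's `HodgeCM.PerL34.RestrictedTensor`).  Complete proofs, no new
axioms, nothing cited.  Released under the package licence.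

# Functoriality, equivariance and uniqueness of the restricted Hilbert tensor product
# `⊗′_i (H_i, e_i)`

Pure functional analysis: NO statement of PerL / QW8 / the 2001 programme is cited or used.

## What is constructed (kernel-checked; Mathlib + `RestrictedTensor` + `RestrictedTensorL2` §1 only)

`RestrictedTensor` builds `Space 𝓔 = ⊗′_i (H_i, e_i)` (completion of the GNS pre-Hilbert space of the
product kernel `kfun x y = ∏ᶠ i, ⟪x i, y i⟫` on restricted families `x : RVec 𝓔`, total pure tensors
`tp 𝓔 x`) and `RestrictedTensorL2` §1 its universal property: a kernel map `Φ : RVec 𝓔 → F`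
(`⟪Φ x, Φ y⟫ = kfun x y`, `F` complete) has THE isometric extension `lift Φ hΦ : Space 𝓔 →ₗᵢ[ℂ] F`,
`lift Φ hΦ (tp x) = Φ x`.  On top of that, by name, this file adds:

* the unitary case: `lift Φ hΦ` is onto — hence a unitary `liftEquiv Φ hΦ hd : Space 𝓔 ≃ₗᵢ[ℂ] F` —
  as soon as the `Φ x` span a dense subspace (`surjective_lift`, `liftEquiv_tp`,
  `liftEquiv_symm_apply`); `lift (tp 𝓔) _ = id` (`lift_tp_self`);
* UNIQUENESS OF THE MODEL: two kernel maps with total images have canonically unitarily equivalent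
  targets, `Φ x ↦ Φ₂ x` (`modelEquiv`, `modelEquiv_apply`) — any two constructions of
  `⊗′_i (H_i, e_i)` (abstract, or as functions on an adelic space) agree;
* NATURALITY (`lift_natural`) and EQUIVARIANCE: if a unitary representation `π` of
  `Πʳ i, [G i, B i]` on `F` satisfies `π g (Φ x) = Φ (g • x)` on restricted families, then `lift Φ hΦ`
  intertwines the restricted tensor product representation `rep hρ = ⊗′ ρ_i` with `π`
  (`lift_rep`, `liftEquiv_rep`, `liftEquiv_symm_rep`, `modelEquiv_rep`);
* FUNCTORIALITY: local isometries `V i : H i →ₗᵢ[ℂ] H' i` with `V i (e i) = e' i` for almost all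
  `i` induce `tmap V hV : ⊗′ (H_i, e_i) →ₗᵢ[ℂ] ⊗′ (H'_i, e'_i)`, `tmap V hV (tp x) = tp (i ↦ V i (x i))`
  (`tmap_tp`), compatible with identities and composition (`tmap_id_apply`, `tmap_comp_apply`),
  a unitary when the `V i` are (`tmapEquiv`, `tmapEquiv_symm_tp`), and intertwining `⊗′ ρ_i` with
  `⊗′ ρ'_i` when each `V i` intertwines `ρ i` with `ρ' i` (`tmap_rep`, `tmapEquiv_rep`);
* TAIL-DEPENDENCE ONLY: unit families on the same local spaces that eventually agree give
  canonically (componentwise identity) isomorphic restricted tensor products and representations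
  (`congrVac`, `congrVac_tp`, `congrVac_rep`).
-/
import Summits.HodgeConjecture.HodgeCM.PerL34.RestrictedTensorL2

set_option autoImplicit false

noncomputable section

open Function Set Filter
open scoped InnerProductSpace ComplexConjugate RestrictedProduct

namespace HodgeCM.PerL34.RestrictedTensor

universe u v

variable {ι : Type u} {H : ι → Type v} [∀ i, NormedAddCommGroup (H i)]
  [∀ i, InnerProductSpace ℂ (H i)] {𝓔 : UnitFamily H}

/-! ## §1 Complements to the universal property: uniqueness, the unitary case -/

section lift

variable {K : Type*} [NormedAddCommGroup K] [InnerProductSpace ℂ K] [CompleteSpace K]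

/-- The pure-tensor map itself is a kernel map. -/
theorem kernel_tp : ∀ x y : RVec 𝓔, ⟪tp 𝓔 x, tp 𝓔 y⟫_ℂ = kfun x y := inner_tp_tp

/-- Uniqueness of the lift, pointwise form of `eq_lift`. -/
theorem lift_unique_apply (Φ : RVec 𝓔 → K) (hΦ : ∀ x y, ⟪Φ x, Φ y⟫_ℂ = kfun x y)
    (A : Space 𝓔 →L[ℂ] K) (hA : ∀ x, A (tp 𝓔 x) = Φ x) (z : Space 𝓔) : lift Φ hΦ z = A z := by
  rw [eq_lift Φ hΦ A hA]; rfl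

/-- The lift of the pure-tensor map is the identity of `⊗′ H`. -/
theorem lift_tp_self (z : Space 𝓔) : lift (tp 𝓔) kernel_tp z = z :=
  lift_unique_apply (tp 𝓔) kernel_tp (ContinuousLinearMap.id ℂ (Space 𝓔)) (fun _ => rfl) z

/-- (Ported verbatim from the HodgeCMPerL package; no docstring in the source.) -/
theorem inner_lift_lift (Φ : RVec 𝓔 → K) (hΦ : ∀ x y, ⟪Φ x, Φ y⟫_ℂ = kfun x y)
    (z w : Space 𝓔) : ⟪lift Φ hΦ z, lift Φ hΦ w⟫_ℂ = ⟪z, w⟫_ℂ :=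
  (lift Φ hΦ).inner_map_map z w

/-- (Ported verbatim from the HodgeCMPerL package; no docstring in the source.) -/
theorem isClosed_range_lift (Φ : RVec 𝓔 → K) (hΦ : ∀ x y, ⟪Φ x, Φ y⟫_ℂ = kfun x y) :
    IsClosed (Set.range (lift Φ hΦ)) :=
  (lift Φ hΦ).isometry.isClosedEmbedding.isClosed_range

/-- (Ported verbatim from the HodgeCMPerL package; no docstring in the source.) -/
theorem span_range_subset_range_lift (Φ : RVec 𝓔 → K) (hΦ : ∀ x y, ⟪Φ x, Φ y⟫_ℂ = kfun x y) :
    ((Submodule.span ℂ (Set.range Φ) : Submodule ℂ K) : Set K) ⊆ Set.range (lift Φ hΦ) := by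
  have h : ((Submodule.span ℂ (Set.range Φ) : Submodule ℂ K) : Set K) ⊆
      (LinearMap.range (lift Φ hΦ).toLinearMap : Set K) := by
    refine SetLike.coe_subset_coe.mpr (Submodule.span_le.mpr ?_)
    rintro _ ⟨x, rfl⟩
    exact LinearMap.mem_range.mpr ⟨tp 𝓔 x, lift_tp Φ hΦ x⟩
  rwa [LinearMap.coe_range] at h

/-- The lift is ONTO as soon as the `Φ x` span a dense subspace of `K`. -/
theorem surjective_lift (Φ : RVec 𝓔 → K) (hΦ : ∀ x y, ⟪Φ x, Φ y⟫_ℂ = kfun x y)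
    (hd : Dense ((Submodule.span ℂ (Set.range Φ) : Submodule ℂ K) : Set K)) :
    Function.Surjective (lift Φ hΦ) := by
  have hdense : Dense (Set.range (lift Φ hΦ)) := hd.mono (span_range_subset_range_lift Φ hΦ)
  rw [← Set.range_eq_univ, ← (isClosed_range_lift Φ hΦ).closure_eq, hdense.closure_eq]

/-- **The lift is unitary** when the `Φ x` are total: `⊗′_i (H_i, e_i) ≃ₗᵢ[ℂ] K`. -/
def liftEquiv (Φ : RVec 𝓔 → K) (hΦ : ∀ x y, ⟪Φ x, Φ y⟫_ℂ = kfun x y)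
    (hd : Dense ((Submodule.span ℂ (Set.range Φ) : Submodule ℂ K) : Set K)) :
    Space 𝓔 ≃ₗᵢ[ℂ] K :=
  LinearIsometryEquiv.ofSurjective (lift Φ hΦ) (surjective_lift Φ hΦ hd)

/-- (Ported verbatim from the HodgeCMPerL package; no docstring in the source.) -/
@[simp] theorem liftEquiv_apply (Φ : RVec 𝓔 → K) (hΦ : ∀ x y, ⟪Φ x, Φ y⟫_ℂ = kfun x y)
    (hd : Dense ((Submodule.span ℂ (Set.range Φ) : Submodule ℂ K) : Set K)) (z : Space 𝓔) :
    liftEquiv Φ hΦ hd z = lift Φ hΦ z := rfl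

/-- (Ported verbatim from the HodgeCMPerL package; no docstring in the source.) -/
theorem liftEquiv_tp (Φ : RVec 𝓔 → K) (hΦ : ∀ x y, ⟪Φ x, Φ y⟫_ℂ = kfun x y)
    (hd : Dense ((Submodule.span ℂ (Set.range Φ) : Submodule ℂ K) : Set K)) (x : RVec 𝓔) :
    liftEquiv Φ hΦ hd (tp 𝓔 x) = Φ x :=
  lift_tp Φ hΦ x

/-- (Ported verbatim from the HodgeCMPerL package; no docstring in the source.) -/
theorem liftEquiv_symm_apply (Φ : RVec 𝓔 → K) (hΦ : ∀ x y, ⟪Φ x, Φ y⟫_ℂ = kfun x y)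
    (hd : Dense ((Submodule.span ℂ (Set.range Φ) : Submodule ℂ K) : Set K)) (x : RVec 𝓔) :
    (liftEquiv Φ hΦ hd).symm (Φ x) = tp 𝓔 x :=
  (liftEquiv Φ hΦ hd).injective (by rw [LinearIsometryEquiv.apply_symm_apply, liftEquiv_tp])

/-! ### Naturality of the lift; uniqueness of the model -/

universe u₂ v₂

variable {ι₂ : Type u₂} {H₂ : ι₂ → Type v₂} [∀ i, NormedAddCommGroup (H₂ i)]
  [∀ i, InnerProductSpace ℂ (H₂ i)] {𝓔₂ : UnitFamily H₂}
  {K₂ : Type*} [NormedAddCommGroup K₂] [InnerProductSpace ℂ K₂] [CompleteSpace K₂]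

/-- **Naturality**: if `A : ⊗′ H → ⊗′ H₂` maps pure tensors along `u` and `U : K → K₂` maps
`Φ x ↦ Φ₂ (u x)`, then `lift Φ₂ ∘ A = U ∘ lift Φ`. -/
theorem lift_natural (Φ : RVec 𝓔 → K) (hΦ : ∀ x y, ⟪Φ x, Φ y⟫_ℂ = kfun x y)
    (Φ₂ : RVec 𝓔₂ → K₂) (hΦ₂ : ∀ x y, ⟪Φ₂ x, Φ₂ y⟫_ℂ = kfun x y)
    {A : Space 𝓔 →L[ℂ] Space 𝓔₂} {U : K →L[ℂ] K₂} (u : RVec 𝓔 → RVec 𝓔₂)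
    (hA : ∀ x, A (tp 𝓔 x) = tp 𝓔₂ (u x)) (hU : ∀ x, U (Φ x) = Φ₂ (u x)) (z : Space 𝓔) :
    lift Φ₂ hΦ₂ (A z) = U (lift Φ hΦ z) := by
  have h : (lift Φ₂ hΦ₂).toContinuousLinearMap.comp A =
      U.comp (lift Φ hΦ).toContinuousLinearMap :=
    clm_ext fun x => by
      simp only [ContinuousLinearMap.comp_apply, LinearIsometry.coe_toContinuousLinearMap, hA,
        lift_tp, hU]
  simpa using congrArg (fun B : Space 𝓔 →L[ℂ] K₂ => B z) h

/-- **Uniqueness of the model**: two kernel maps with total images have canonically unitarily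
equivalent targets, `Φ x ↦ Φ₂ x`.  (Any two constructions of `⊗′_i (H_i, e_i)` agree.) -/
def modelEquiv (Φ : RVec 𝓔 → K) (hΦ : ∀ x y, ⟪Φ x, Φ y⟫_ℂ = kfun x y)
    (hd : Dense ((Submodule.span ℂ (Set.range Φ) : Submodule ℂ K) : Set K))
    (Φ₂ : RVec 𝓔 → K₂) (hΦ₂ : ∀ x y, ⟪Φ₂ x, Φ₂ y⟫_ℂ = kfun x y)
    (hd₂ : Dense ((Submodule.span ℂ (Set.range Φ₂) : Submodule ℂ K₂) : Set K₂)) : K ≃ₗᵢ[ℂ] K₂ :=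
  (liftEquiv Φ hΦ hd).symm.trans (liftEquiv Φ₂ hΦ₂ hd₂)

/-- (Ported verbatim from the HodgeCMPerL package; no docstring in the source.) -/
theorem modelEquiv_apply (Φ : RVec 𝓔 → K) (hΦ : ∀ x y, ⟪Φ x, Φ y⟫_ℂ = kfun x y)
    (hd : Dense ((Submodule.span ℂ (Set.range Φ) : Submodule ℂ K) : Set K))
    (Φ₂ : RVec 𝓔 → K₂) (hΦ₂ : ∀ x y, ⟪Φ₂ x, Φ₂ y⟫_ℂ = kfun x y)
    (hd₂ : Dense ((Submodule.span ℂ (Set.range Φ₂) : Submodule ℂ K₂) : Set K₂)) (x : RVec 𝓔) :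
    modelEquiv Φ hΦ hd Φ₂ hΦ₂ hd₂ (Φ x) = Φ₂ x := by
  rw [modelEquiv, LinearIsometryEquiv.trans_apply, liftEquiv_symm_apply, liftEquiv_tp]

/-! ### Equivariance: the lift intertwines `⊗′ ρ_i` with any compatible representation on `K` -/

section equivariance

variable {G : ι → Type*} [∀ i, Group (G i)] {Sub : ι → Type*} [∀ i, SetLike (Sub i) (G i)]
  {B : ∀ i, Sub i} {ρ : ∀ i, G i →* (H i ≃ₗᵢ[ℂ] H i)} (hρ : Admissible 𝓔 B ρ)
  [∀ i, SubgroupClass (Sub i) (G i)]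

/-- If `U (Φ x) = Φ (g • x)` for all restricted families `x`, then `lift (rep g z) = U (lift z)`. -/
theorem lift_rep_of_clm (Φ : RVec 𝓔 → K) (hΦ : ∀ x y, ⟪Φ x, Φ y⟫_ℂ = kfun x y)
    (g : Πʳ i, [G i, B i]) (U : K →L[ℂ] K) (hU : ∀ x, U (Φ x) = Φ (gact hρ g x))
    (z : Space 𝓔) : lift Φ hΦ (rep hρ g z) = U (lift Φ hΦ z) :=
  lift_natural Φ hΦ Φ hΦ (A := actL hρ g) (gact hρ g) (actL_tp hρ g) hU z

/-- **Equivariance of the lift.**  If a unitary representation `π` of `Πʳ i, [G i, B i]` on `K`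
acts on the vectors `Φ x` as `⊗′ ρ_i` acts on pure tensors, `π g (Φ x) = Φ (i ↦ ρ i (g i) (x i))`,
then `lift Φ` is an intertwiner `(⊗′ H, ⊗′ ρ) → (K, π)`. -/
theorem lift_rep (Φ : RVec 𝓔 → K) (hΦ : ∀ x y, ⟪Φ x, Φ y⟫_ℂ = kfun x y)
    (π : (Πʳ i, [G i, B i]) →* (K ≃ₗᵢ[ℂ] K)) (hπ : ∀ g x, π g (Φ x) = Φ (gact hρ g x))
    (g : Πʳ i, [G i, B i]) (z : Space 𝓔) : lift Φ hΦ (rep hρ g z) = π g (lift Φ hΦ z) :=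
  lift_rep_of_clm hρ Φ hΦ g ((π g : K ≃ₗᵢ[ℂ] K) : K →L[ℂ] K) (fun x => hπ g x) z

/-- … and so is the unitary `liftEquiv Φ` when the `Φ x` are total, in both directions. -/
theorem liftEquiv_rep (Φ : RVec 𝓔 → K) (hΦ : ∀ x y, ⟪Φ x, Φ y⟫_ℂ = kfun x y)
    (hd : Dense ((Submodule.span ℂ (Set.range Φ) : Submodule ℂ K) : Set K))
    (π : (Πʳ i, [G i, B i]) →* (K ≃ₗᵢ[ℂ] K)) (hπ : ∀ g x, π g (Φ x) = Φ (gact hρ g x))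
    (g : Πʳ i, [G i, B i]) (z : Space 𝓔) :
    liftEquiv Φ hΦ hd (rep hρ g z) = π g (liftEquiv Φ hΦ hd z) :=
  lift_rep hρ Φ hΦ π hπ g z

/-- (Ported verbatim from the HodgeCMPerL package; no docstring in the source.) -/
theorem liftEquiv_symm_rep (Φ : RVec 𝓔 → K) (hΦ : ∀ x y, ⟪Φ x, Φ y⟫_ℂ = kfun x y)
    (hd : Dense ((Submodule.span ℂ (Set.range Φ) : Submodule ℂ K) : Set K))
    (π : (Πʳ i, [G i, B i]) →* (K ≃ₗᵢ[ℂ] K)) (hπ : ∀ g x, π g (Φ x) = Φ (gact hρ g x))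
    (g : Πʳ i, [G i, B i]) (k : K) :
    (liftEquiv Φ hΦ hd).symm (π g k) = rep hρ g ((liftEquiv Φ hΦ hd).symm k) := by
  apply (liftEquiv Φ hΦ hd).injective
  rw [LinearIsometryEquiv.apply_symm_apply, liftEquiv_rep hρ Φ hΦ hd π hπ,
    LinearIsometryEquiv.apply_symm_apply]

/-- … hence the canonical unitary `modelEquiv` between two models with TOTAL equivariant kernel maps
intertwines the two representations: the pair `(K, π|·)` is determined up to unitary equivalence. -/
theorem modelEquiv_rep (Φ : RVec 𝓔 → K) (hΦ : ∀ x y, ⟪Φ x, Φ y⟫_ℂ = kfun x y)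
    (hd : Dense ((Submodule.span ℂ (Set.range Φ) : Submodule ℂ K) : Set K))
    (Φ₂ : RVec 𝓔 → K₂) (hΦ₂ : ∀ x y, ⟪Φ₂ x, Φ₂ y⟫_ℂ = kfun x y)
    (hd₂ : Dense ((Submodule.span ℂ (Set.range Φ₂) : Submodule ℂ K₂) : Set K₂))
    (π : (Πʳ i, [G i, B i]) →* (K ≃ₗᵢ[ℂ] K)) (hπ : ∀ g x, π g (Φ x) = Φ (gact hρ g x))
    (π₂ : (Πʳ i, [G i, B i]) →* (K₂ ≃ₗᵢ[ℂ] K₂)) (hπ₂ : ∀ g x, π₂ g (Φ₂ x) = Φ₂ (gact hρ g x))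
    (g : Πʳ i, [G i, B i]) (k : K) :
    modelEquiv Φ hΦ hd Φ₂ hΦ₂ hd₂ (π g k) = π₂ g (modelEquiv Φ hΦ hd Φ₂ hΦ₂ hd₂ k) := by
  rw [modelEquiv, LinearIsometryEquiv.trans_apply, LinearIsometryEquiv.trans_apply,
    liftEquiv_symm_rep hρ Φ hΦ hd π hπ, liftEquiv_rep hρ Φ₂ hΦ₂ hd₂ π₂ hπ₂]

end equivariance

end lift

/-! ## §2 Functoriality in the local spaces -/

section functoriality

universe v' v''

variable {H' : ι → Type v'} [∀ i, NormedAddCommGroup (H' i)] [∀ i, InnerProductSpace ℂ (H' i)]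
  {𝓔' : UnitFamily H'}
  {H'' : ι → Type v''} [∀ i, NormedAddCommGroup (H'' i)] [∀ i, InnerProductSpace ℂ (H'' i)]
  {𝓔'' : UnitFamily H''}

/-- Push a restricted family through local isometries `V i` mapping `e i ↦ e' i` for almost all
`i`. -/
def mapVec (V : ∀ i, H i →ₗᵢ[ℂ] H' i) (hV : ∀ᶠ i in cofinite, V i (𝓔.e i) = 𝓔'.e i)
    (x : RVec 𝓔) : RVec 𝓔' :=
  ⟨fun i => V i (x i), (x.eventually_eq.and hV).mono fun i hi => by rw [hi.1, hi.2]⟩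

/-- (Ported verbatim from the HodgeCMPerL package; no docstring in the source.) -/
@[simp] theorem mapVec_apply (V : ∀ i, H i →ₗᵢ[ℂ] H' i)
    (hV : ∀ᶠ i in cofinite, V i (𝓔.e i) = 𝓔'.e i) (x : RVec 𝓔) (i : ι) :
    mapVec V hV x i = V i (x i) := rfl

/-- (Ported verbatim from the HodgeCMPerL package; no docstring in the source.) -/
theorem kfun_mapVec (V : ∀ i, H i →ₗᵢ[ℂ] H' i) (hV : ∀ᶠ i in cofinite, V i (𝓔.e i) = 𝓔'.e i)
    (x y : RVec 𝓔) : kfun (mapVec V hV x) (mapVec V hV y) = kfun x y :=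
  finprod_congr fun i => (V i).inner_map_map _ _

/-- `x ↦ ⊗_i V_i x_i` is a kernel map. -/
theorem kernel_tp_mapVec (V : ∀ i, H i →ₗᵢ[ℂ] H' i)
    (hV : ∀ᶠ i in cofinite, V i (𝓔.e i) = 𝓔'.e i) :
    ∀ x y : RVec 𝓔, ⟪tp 𝓔' (mapVec V hV x), tp 𝓔' (mapVec V hV y)⟫_ℂ = kfun x y :=
  fun x y => by rw [inner_tp_tp, kfun_mapVec]

/-- **Functoriality**: `⊗′_i V_i : ⊗′_i (H_i, e_i) →ₗᵢ[ℂ] ⊗′_i (H'_i, e'_i)` for local isometries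
with `V i (e i) = e' i` for almost all `i`. -/
def tmap (V : ∀ i, H i →ₗᵢ[ℂ] H' i) (hV : ∀ᶠ i in cofinite, V i (𝓔.e i) = 𝓔'.e i) :
    Space 𝓔 →ₗᵢ[ℂ] Space 𝓔' :=
  lift (fun x => tp 𝓔' (mapVec V hV x)) (kernel_tp_mapVec V hV)

/-- (Ported verbatim from the HodgeCMPerL package; no docstring in the source.) -/
@[simp] theorem tmap_tp (V : ∀ i, H i →ₗᵢ[ℂ] H' i)
    (hV : ∀ᶠ i in cofinite, V i (𝓔.e i) = 𝓔'.e i) (x : RVec 𝓔) :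
    tmap V hV (tp 𝓔 x) = tp 𝓔' (mapVec V hV x) :=
  lift_tp _ (kernel_tp_mapVec V hV) x

/-- `tmap` only depends on the values of the maps (not on the proof `hV`). -/
theorem tmap_congr {V W : ∀ i, H i →ₗᵢ[ℂ] H' i} (hV : ∀ᶠ i in cofinite, V i (𝓔.e i) = 𝓔'.e i)
    (hW : ∀ᶠ i in cofinite, W i (𝓔.e i) = 𝓔'.e i) (h : ∀ i v, V i v = W i v) (z : Space 𝓔) :
    tmap V hV z = tmap W hW z :=
  lift_unique_apply _ (kernel_tp_mapVec V hV) (tmap W hW).toContinuousLinearMap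
    (fun x => by
      rw [LinearIsometry.coe_toContinuousLinearMap, tmap_tp]
      exact congrArg (tp 𝓔') (RVec.ext fun i => (h i (x i)).symm)) z

/-- `⊗′ id = id`. -/
theorem tmap_id_apply
    (hV : ∀ᶠ i in cofinite, (LinearIsometry.id : H i →ₗᵢ[ℂ] H i) (𝓔.e i) = 𝓔.e i)
    (z : Space 𝓔) : tmap (fun _ => LinearIsometry.id) hV z = z :=
  lift_unique_apply _ (kernel_tp_mapVec (fun _ => LinearIsometry.id) hV)
    (ContinuousLinearMap.id ℂ (Space 𝓔))
    (fun x => by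
      rw [ContinuousLinearMap.id_apply]
      exact congrArg (tp 𝓔) (RVec.ext fun i => rfl)) z

/-- (Ported verbatim from the HodgeCMPerL package; no docstring in the source.) -/
theorem eventually_comp_apply_e (V : ∀ i, H i →ₗᵢ[ℂ] H' i)
    (hV : ∀ᶠ i in cofinite, V i (𝓔.e i) = 𝓔'.e i) (V' : ∀ i, H' i →ₗᵢ[ℂ] H'' i)
    (hV' : ∀ᶠ i in cofinite, V' i (𝓔'.e i) = 𝓔''.e i) :
    ∀ᶠ i in cofinite, (V' i).comp (V i) (𝓔.e i) = 𝓔''.e i :=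
  (hV.and hV').mono fun i hi => by
    change V' i (V i (𝓔.e i)) = 𝓔''.e i
    rw [hi.1, hi.2]

/-- `⊗′ (V'_i ∘ V_i) = (⊗′ V'_i) ∘ (⊗′ V_i)`. -/
theorem tmap_comp_apply (V : ∀ i, H i →ₗᵢ[ℂ] H' i)
    (hV : ∀ᶠ i in cofinite, V i (𝓔.e i) = 𝓔'.e i) (V' : ∀ i, H' i →ₗᵢ[ℂ] H'' i)
    (hV' : ∀ᶠ i in cofinite, V' i (𝓔'.e i) = 𝓔''.e i)
    (hVV' : ∀ᶠ i in cofinite, (V' i).comp (V i) (𝓔.e i) = 𝓔''.e i) (z : Space 𝓔) :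
    tmap (fun i => (V' i).comp (V i)) hVV' z = tmap V' hV' (tmap V hV z) :=
  lift_unique_apply _ (kernel_tp_mapVec (fun i => (V' i).comp (V i)) hVV')
    ((tmap V' hV').toContinuousLinearMap.comp (tmap V hV).toContinuousLinearMap)
    (fun x => by
      rw [ContinuousLinearMap.comp_apply, LinearIsometry.coe_toContinuousLinearMap,
        LinearIsometry.coe_toContinuousLinearMap, tmap_tp, tmap_tp]
      exact congrArg (tp 𝓔'') (RVec.ext fun i => rfl)) z

/-! ### Unitary local maps give a unitary `⊗′ V_i` -/

/-- (Ported verbatim from the HodgeCMPerL package; no docstring in the source.) -/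
theorem eventually_symm_apply_e (V : ∀ i, H i ≃ₗᵢ[ℂ] H' i)
    (hV : ∀ᶠ i in cofinite, V i (𝓔.e i) = 𝓔'.e i) :
    ∀ᶠ i in cofinite, (V i).symm (𝓔'.e i) = 𝓔.e i :=
  hV.mono fun i hi => by rw [← hi, LinearIsometryEquiv.symm_apply_apply]

/-- (Ported verbatim from the HodgeCMPerL package; no docstring in the source.) -/
theorem mapVec_symm_mapVec (V : ∀ i, H i ≃ₗᵢ[ℂ] H' i)
    (hV : ∀ᶠ i in cofinite, V i (𝓔.e i) = 𝓔'.e i) (y : RVec 𝓔') :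
    mapVec (fun i => (V i).toLinearIsometry) hV
      (mapVec (fun i => (V i).symm.toLinearIsometry) (eventually_symm_apply_e V hV) y) = y :=
  RVec.ext fun i => (V i).apply_symm_apply (y i)

/-- (Ported verbatim from the HodgeCMPerL package; no docstring in the source.) -/
theorem dense_span_range_tp_mapVec (V : ∀ i, H i ≃ₗᵢ[ℂ] H' i)
    (hV : ∀ᶠ i in cofinite, V i (𝓔.e i) = 𝓔'.e i) :
    Dense ((Submodule.span ℂ (Set.range fun x : RVec 𝓔 =>
      tp 𝓔' (mapVec (fun i => (V i).toLinearIsometry) hV x)) : Submodule ℂ (Space 𝓔')) :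
      Set (Space 𝓔')) := by
  refine (dense_span_tp (𝓔 := 𝓔')).mono (SetLike.coe_subset_coe.mpr (Submodule.span_mono ?_))
  rintro _ ⟨y, rfl⟩
  exact ⟨mapVec (fun i => (V i).symm.toLinearIsometry) (eventually_symm_apply_e V hV) y,
    congrArg (tp 𝓔') (mapVec_symm_mapVec V hV y)⟩

/-- **Functoriality, unitary case**: `⊗′_i V_i : ⊗′_i (H_i, e_i) ≃ₗᵢ[ℂ] ⊗′_i (H'_i, e'_i)` for
local unitaries with `V i (e i) = e' i` for almost all `i`. -/
def tmapEquiv (V : ∀ i, H i ≃ₗᵢ[ℂ] H' i) (hV : ∀ᶠ i in cofinite, V i (𝓔.e i) = 𝓔'.e i) :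
    Space 𝓔 ≃ₗᵢ[ℂ] Space 𝓔' :=
  liftEquiv _ (kernel_tp_mapVec (fun i => (V i).toLinearIsometry) hV)
    (dense_span_range_tp_mapVec V hV)

/-- (Ported verbatim from the HodgeCMPerL package; no docstring in the source.) -/
theorem tmapEquiv_apply (V : ∀ i, H i ≃ₗᵢ[ℂ] H' i)
    (hV : ∀ᶠ i in cofinite, V i (𝓔.e i) = 𝓔'.e i) (z : Space 𝓔) :
    tmapEquiv V hV z = tmap (fun i => (V i).toLinearIsometry) hV z := rfl

/-- (Ported verbatim from the HodgeCMPerL package; no docstring in the source.) -/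
@[simp] theorem tmapEquiv_tp (V : ∀ i, H i ≃ₗᵢ[ℂ] H' i)
    (hV : ∀ᶠ i in cofinite, V i (𝓔.e i) = 𝓔'.e i) (x : RVec 𝓔) :
    tmapEquiv V hV (tp 𝓔 x) = tp 𝓔' (mapVec (fun i => (V i).toLinearIsometry) hV x) :=
  liftEquiv_tp _ (kernel_tp_mapVec _ hV) _ x

/-- (Ported verbatim from the HodgeCMPerL package; no docstring in the source.) -/
theorem tmapEquiv_symm_tp (V : ∀ i, H i ≃ₗᵢ[ℂ] H' i)
    (hV : ∀ᶠ i in cofinite, V i (𝓔.e i) = 𝓔'.e i) (y : RVec 𝓔') :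
    (tmapEquiv V hV).symm (tp 𝓔' y) =
      tp 𝓔 (mapVec (fun i => (V i).symm.toLinearIsometry) (eventually_symm_apply_e V hV) y) :=
  (tmapEquiv V hV).injective (by
    rw [LinearIsometryEquiv.apply_symm_apply, tmapEquiv_tp, mapVec_symm_mapVec])

/-! ### Equivariance of `⊗′ V_i` -/

section equivariance

variable {G : ι → Type*} [∀ i, Group (G i)] {Sub : ι → Type*} [∀ i, SetLike (Sub i) (G i)]
  {B : ∀ i, Sub i} {ρ : ∀ i, G i →* (H i ≃ₗᵢ[ℂ] H i)} {ρ' : ∀ i, G i →* (H' i ≃ₗᵢ[ℂ] H' i)}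
  (hρ : Admissible 𝓔 B ρ) (hρ' : Admissible 𝓔' B ρ')

/-- (Ported verbatim from the HodgeCMPerL package; no docstring in the source.) -/
theorem mapVec_gact (V : ∀ i, H i →ₗᵢ[ℂ] H' i) (hV : ∀ᶠ i in cofinite, V i (𝓔.e i) = 𝓔'.e i)
    (hint : ∀ i (g : G i) (v : H i), V i (ρ i g v) = ρ' i g (V i v)) (g : Πʳ i, [G i, B i])
    (x : RVec 𝓔) : mapVec V hV (gact hρ g x) = gact hρ' g (mapVec V hV x) :=
  RVec.ext fun i => hint i (g i) (x i)

variable [∀ i, SubgroupClass (Sub i) (G i)]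

/-- **Equivariance of `⊗′ V_i`**: local intertwiners `V i ∘ ρ i g = ρ' i g ∘ V i` give an
intertwiner `⊗′ ρ_i → ⊗′ ρ'_i`. -/
theorem tmap_rep (V : ∀ i, H i →ₗᵢ[ℂ] H' i) (hV : ∀ᶠ i in cofinite, V i (𝓔.e i) = 𝓔'.e i)
    (hint : ∀ i (g : G i) (v : H i), V i (ρ i g v) = ρ' i g (V i v)) (g : Πʳ i, [G i, B i])
    (z : Space 𝓔) : tmap V hV (rep hρ g z) = rep hρ' g (tmap V hV z) :=
  lift_natural _ (kernel_tp_mapVec V hV) _ (kernel_tp_mapVec V hV) (A := actL hρ g)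
    (U := actL hρ' g) (gact hρ g) (actL_tp hρ g)
    (fun x => by rw [actL_tp, mapVec_gact hρ hρ' V hV hint]) z


-- port_pkg: scope closed for this part
end equivariance
end functoriality
end HodgeCM.PerL34.RestrictedTensor
end
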